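import Summits.ABC.IUTFork.Joshi.ATS4LocusUpperBounds
import Summits.ABC.IUTFork.Joshi.ATS4MainBounds
import Literature.IUT.LogVolume.Theorem110

/-!
# Joshi, *Arithmetic Teichmüller Spaces IV* (arXiv:2403.10430v2) §6.12 across the seats: Thm 6.10.1 ⟹ `C_Θ ≥ −1` ⟹ Thm 6.1.1 —
# E-t31's §6.8–§6.11 carrier glued to E-t30's Thm 6.1.1 carrier and to the tree's [IUTchIV] Thm 1.10 numerics

Bridge file of the abc-iut cell, branch E (rung LADDER-ABC:A2.E; seat abc-iut-E-t31, slot T-31, merge-debt reconciliation; sibling of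
`Joshi/ATS4DescentSpine.lean`). **No side is taken** on [IUTchIII] Cor. 3.12 / [IUTchIV] Thm 1.10, on Joshi's claims (unrefereed arXiv
preprints) or on Mochizuki's report on them; typed ≠ proved ≠ endorsed; every printed assertion stays a hypothesis BY NAME (the
lower bound = [J-III] Cor 9.11.1.1 at `φ(y₀)` enters as E-t31's `LowerBound`; its identification with E-t4's typing is the sibling's
`DescentGlue.lowerBound_of_cor91111`). PROVED:

1. `lem642_iff`: E-t31's input predicate `LocusVolumeDatum.Lem642₂` ⟺ E-t30's `MainBoundDatum.Lem642b` (Lemma 6.4.2 (2), p.60 l.6–21;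
   `Joshi/ATS4MainBounds.lean`).
2. `cTheta_eq_thm110`: under «(1/2ℓ) log(q) = |log(q_ℓ)|» (p.71 l.107–110) the printed `C_Θ` of Thm 6.10.1 (p.66 l.44–61) IS the tree's
   [IUTchIV] Thm 1.10 constant `Literature.IUT.LogVolume.Thm110Numerics.CTheta` at `η_prm = 60`, through E-t30's dictionary
   `MainBoundDatum.toThm110` (Rmk 6.1.2 «the same as [IUTchIV, Thm 1.10] with η_prm = 60», p.58 l.24–27).
3. `thm611_left_of_thm6101`: Thm 6.10.1 ⟹ `C_Θ ≥ −1` (§6.12 p.72 l.2–15) ⟹ — by the tree's PROVED last paragraph of [IUTchIV] Thm 1.10,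
   `Thm110Numerics.display_of_neg_one_le_CTheta`, which needs `ℓ ≥ 7` ([J-IV] p.72 l.31 «Finally one uses ℓ ≥ 7») — the first
   inequality of Thm 6.1.1 (p.58 l.5–16), via E-t30's `thm611_left_iff_display`.
4. `thm611_left_of_inputs`: THE E5 DESCENT SPINE END TO END — the lower bound (Cor 9.11.1.1 at `φ(y₀)`) + Lemma 6.4.1, Thm 4.6.1
   (5) for `L′/L`, `[L′ : L] ≤ ℓ⁴` (E-t30) + (6.11.1), Prop 6.10.9 on `V^dst_ℚ`, the component sums, (6.8.11), Lemma 6.7.8, the two shift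
   equalities, «(1/2ℓ) log q = |log q_ℓ|», the lower bound (E-t31) + the glue + `ℓ ≥ 7` ⟹ Thm 6.1.1's first inequality. This is the list of named
   places where print carries the descent from [J-III] Cor 9.11.1.1 to [J-IV] Thm 6.1.1; none is discharged here.

Shape (E-PLAN R2/R9): volume-shaped, S-bypassed; no TEST line. Bridge file (R14): imports Joshi object files and Literature only.
[claim: Joshi2024ATS4, status: disputed]; [claim: Joshi2024ATS3, status: disputed]; [claim: Mochizuki2012, status: disputed].
-/

noncomputable section

namespace Summit.ABC.IUTFork.Joshi.ATS4

open Literature.IUT.LogVolume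

/-- **The identifications between E-t31's §6.8–§6.11 carrier and E-t30's Thm 6.1.1 carrier** (OUR READING; the quantities of §4.1.1 /
Prop 6.2.1 / §4.4 / §6.4 that both files carry): `ℓ`, `d_mod`, `e*_mod = 2¹²·3³·5·e_mod`, `η_prm = 60`, `log(d_{L_tpd})`, `log(f_{L_tpd})`,
`log(d_{L′})`, `log(q)`. Never asserted. [claim: Joshi2024ATS4, status: disputed] -/
structure MainBoundGlue (M : MainBoundDatum) (d : LocusVolumeDatum) : Prop where
  /-- `ℓ` -/ l_eq : d.l = M.ell
  /-- `d_mod` -/ dmod_eq : d.dmod = M.dmod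
  /-- `e*_mod` -/ estar_eq : d.estar = (M.estar : ℝ)
  /-- `η_prm = 60` (Prop 6.2.1) -/ eta_eq : d.eta = etaPrm
  /-- `log(d_{L_tpd})` -/ logDiffTpd_eq : d.logDiffTpd = M.logDiffLtpd
  /-- `log(f_{L_tpd})` -/ logCondTpd_eq : d.logCondTpd = M.logCondLtpd
  /-- `log(d_{L′})` -/ logDiffLp_eq : d.logDiffLp = M.logDiffLp
  /-- `log(q)` -/ logq_eq : d.logq = M.logq

namespace MainBoundGlue

variable {M : MainBoundDatum} {d : LocusVolumeDatum} (G : MainBoundGlue M d)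
include G

/-- **Lemma 6.4.2 (2): E-t31's input predicate IS E-t30's typed statement.** [claim: Joshi2024ATS4, status: disputed] -/
theorem lem642_iff : d.Lem642₂ ↔ M.Lem642b := by
  unfold LocusVolumeDatum.Lem642₂ MainBoundDatum.Lem642b
  rw [G.l_eq, G.logDiffLp_eq, G.logDiffTpd_eq, G.logCondTpd_eq]

/-- **`C_Θ` of Thm 6.10.1 = the tree's [IUTchIV] Thm 1.10 constant at `η_prm = 60`** (Rmk 6.1.2), under «(1/2ℓ) log(q) = |log(q_ℓ)|»,
through E-t30's dictionary `MainBoundDatum.toThm110` (any value `θ` of its `−|log(Θ)|` slot: `C_Θ` does not read it). PROVED.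
[claim: Joshi2024ATS4, status: disputed] -/
theorem cTheta_eq_thm110 (hD : d.LogqDictionary) (θ : ℝ) : (M.toThm110 θ).CTheta = d.CTheta := by
  have hA : d.absLogThetaQ = M.logq / (2 * (M.ell : ℝ)) := by
    unfold LocusVolumeDatum.LogqDictionary at hD; rw [← hD, G.logq_eq, G.l_eq]; ring
  unfold LocusVolumeDatum.CTheta LocusVolumeDatum.bracket
  rw [hA, G.dmod_eq, G.estar_eq, G.eta_eq, G.logDiffTpd_eq, G.logCondTpd_eq, G.logq_eq, G.l_eq]
  simp only [Thm110Numerics.CTheta, Thm110Numerics.bracket, Thm110Numerics.absLogq, MainBoundDatum.toThm110, etaPrm,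
    MainBoundDatum.estar, Thm110Numerics.estar]

/-- **§6.12, first step: Thm 6.10.1 ⟹ `C_Θ ≥ −1` ⟹ the first inequality of Thm 6.1.1** (p.72 l.2–30), for `ℓ ≥ 7` (p.72 l.31), via
the tree's PROVED `Thm110Numerics.display_of_neg_one_le_CTheta` and E-t30's `thm611_left_iff_display`.
[claim: Joshi2024ATS4, status: disputed] -/
theorem thm611_left_of_thm6101 (h7 : 7 ≤ M.ell) (hD : d.LogqDictionary) (h : d.Thm6101) :
    1 / 6 * M.logq ≤ M.boundLtpd := by
  have hC : -1 ≤ d.CTheta := d.neg_one_le_cTheta h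
  have hC' : -1 ≤ (M.toThm110 0).CTheta := by rw [G.cTheta_eq_thm110 hD 0]; exact hC
  have h7' : 7 ≤ (M.toThm110 0).l := h7
  exact (M.thm611_left_iff_display 0).2 (Thm110Numerics.display_of_neg_one_le_CTheta h7' hC')

/-- **THE E5 DESCENT SPINE END TO END (every printed input BY NAME)**: the lower bound ([J-III] Cor 9.11.1.1 at `φ(y₀)`, as E-t31's
`LowerBound`; from E-t4's three [J-III] inputs by `DescentGlue.lowerBound_of_cor91111` in the sibling file) + Lemma 6.4.1, Thm 4.6.1 (5) for `L′/L`, `[L′ : L] ≤ ℓ⁴` (E-t30) + (6.11.1), Prop 6.10.9 on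
`V^dst_ℚ`, the component sums, (6.8.11), Lemma 6.7.8, the two shift equalities, «(1/2ℓ) log q = |log q_ℓ|» (E-t31) + the glue +
`ℓ ≥ 7` ⟹ the first inequality of Thm 6.1.1. PROVED (composition only; nothing of the papers is asserted).
[claim: Joshi2024ATS4, status: disputed] -/
theorem thm611_left_of_inputs (h7 : 7 ≤ M.ell) (m₁ : M.Lem641) (m₂ : M.WildBoundLp) (m₃ : M.DegLpLBound)
    (h₁ : d.Eq6111) (h₂ : ∀ p ∈ d.Vdst, d.Prop6109 p) (h₃ : d.ComponentSums) (h₅ : d.Eq6811) (h₆ : d.Lem678)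
    (h₇ : d.LowerBound) (h₈ : d.FrobShiftQ) (h₉ : d.FrobShiftVol) (hD : d.LogqDictionary) :
    1 / 6 * M.logq ≤ M.boundLtpd := by
  have h₄ : d.Lem642₂ := G.lem642_iff.2 (M.lem642b_of_lem642a (M.lem642a_of m₁ m₂ m₃))
  exact G.thm611_left_of_thm6101 h7 hD (d.thm6101_of_inputs h₁ h₂ h₃ h₄ h₅ h₆ h₇ h₈ h₉ hD)

end MainBoundGlue

end Summit.ABC.IUTFork.Joshi.ATS4

end
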